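import Literature.Probability.LatticeModels.LatticeWalkWinding
import HarnessLib

/-!
# A face about which a closed lattice polygon winds misses a set about which it does not wind
(line `symplectic-fermion-anchor`, crux `SAWLoopFugacityFlow.AvoidanceLimit`, stmt-CriticalPhenomena-10649)

The brick "B3" of the shield lemma, the variant of
`face_subset_of_walkWinding_ne_zero` in which the vanishing of the winding number is the
hypothesis: if the polygon `walkPath p` of a closed nearest-neighbour walk `p` of `ℤ²` does not
wind about any point of a set `K ⊆ ℂ` off the polygon, and the combinatorial winding number
`walkWinding p u` of `p` about the face centre `u + (½, ½)` is non-zero, then every point of the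
closed unit square `[u₀, u₀ + 1] × [u₁, u₁ + 1]` lies either off `K` or on the polygon.

Proof: a point `z` of the square on the polygon is covered by the second alternative. Otherwise
the segment from the face centre `ℓ = u + (½, ½)` to `z` misses the polygon (its points other
than `z` lie in the OPEN square, hence have no integer coordinate, while the polygon lies on the
grid lines), so the polygon winds equally about `ℓ` and about `z`
(`wind_sub_eq_of_mem_connectedComponentIn`); the former winding number is `walkWinding p u ≠ 0`
(`wind_walkPath_sub_faceCentre`), whereas by hypothesis the polygon does not wind about points
of `K` off it, so `z ∉ K`. [folklore]
-/

noncomputable section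

open scoped BigOperators Classical
open Set Complex SimpleGraph
open Literature.Topology.PlaneTopology
open Literature.Probability.Percolation (walkWinding)
open Literature.Probability.LatticeModels

namespace Summit.CriticalPhenomena.SAWScalingLimit.Theorems.AvoidanceLimit.Anchor

/-- **A face about which a closed lattice polygon winds lies, as a closed unit square, in the
union of the polygon and the complement of any set about whose points the polygon does not
wind.** If, for a closed walk `p` of `ℤ²`, the polygon `walkPath p` has winding number `0` about
every point of `K` off the polygon, and `walkWinding p u ≠ 0`, then
`[u₀, u₀ + 1] × [u₁, u₁ + 1] ⊆ Kᶜ ∪ range (walkPath p)`: the polygon winds equally about the face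
centre and about any point of the closed face off the polygon (the joining segment misses the
polygon, which lies on the grid lines), namely `walkWinding p u ≠ 0` times, so such a point is
not in `K`. [folklore] -/
theorem face_subset_of_walkWinding_ne_zero' :
    ∀ (K : Set ℂ) {a : Site 2} (p : (zdGraph 2).Walk a a),
      (∀ q ∈ K, q ∉ range (walkPath p) → wind (fun t => (walkPath p).extend t - q) = 0) →
      ∀ u : Site 2, walkWinding p u ≠ 0 →
        (Icc (u 0 : ℝ) (u 0 + 1) ×ℂ Icc (u 1 : ℝ) (u 1 + 1)) ⊆ Kᶜ ∪ range (walkPath p) := by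
  intro K a p hK u hw z hz
  rw [mem_reProdIm, mem_Icc, mem_Icc] at hz
  obtain ⟨⟨hz0l, hz0r⟩, hz1l, hz1r⟩ := hz
  -- a point of the square on the polygon is covered by the second alternative
  by_cases hzr : z ∈ range (walkPath p)
  · exact Or.inr hzr
  -- otherwise we show `z ∉ K`
  refine Or.inl fun hzK => ?_
  set ℓ : ℂ := ⟨(u 0 : ℝ) + 1 / 2, (u 1 : ℝ) + 1 / 2⟩ with hℓ
  have hℓre : ℓ.re = (u 0 : ℝ) + 1 / 2 := rfl
  have hℓim : ℓ.im = (u 1 : ℝ) + 1 / 2 := rfl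
  -- the winding number about the face centre is `walkWinding p u ≠ 0`
  have hwind : wind (fun t => (walkPath p).extend t - ℓ) = walkWinding p u :=
    wind_walkPath_sub_faceCentre p u
  -- the winding number about `z ∈ K`, a point off the polygon, vanishes by hypothesis
  have hz0 : wind (fun t => (walkPath p).extend t - z) = 0 := hK z hzK hzr
  -- the segment `[ℓ, z]` misses the polygon
  have hseg : segment ℝ ℓ z ⊆ (range (walkPath p))ᶜ := by
    intro w hw' hwr
    obtain ⟨x, -, y, -, hxy, hws⟩ := exists_mem_segment_of_mem_range_walkPath p hwr
    obtain ⟨t, ht0, ht1, hre, him⟩ := exists_of_mem_segment hw'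
    rw [hℓre] at hre
    rw [hℓim] at him
    rcases eq_or_lt_of_le ht1 with rfl | ht1'
    · -- `t = 1`: the point is `z` itself
      have hwz : w = z := Complex.ext (by rw [hre]; ring) (by rw [him]; ring)
      exact hzr (hwz ▸ hwr)
    · -- `t < 1`: the point lies in the open square, off the grid lines
      rcases re_eq_or_im_eq_of_mem_segment hxy hws with h | h
      · have hc1 : 0 ≤ t * (z.re - u 0) := mul_nonneg ht0 (by linarith)
        have hc2 : 0 ≤ t * (u 0 + 1 - z.re) := mul_nonneg ht0 (by linarith)
        have h1 : (u 0 : ℝ) < x 0 := by rw [← h, hre]; nlinarith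
        have h2 : (x 0 : ℝ) < u 0 + 1 := by rw [← h, hre]; nlinarith
        have h1' : u 0 < x 0 := by exact_mod_cast h1
        have h2' : x 0 < u 0 + 1 := by exact_mod_cast h2
        omega
      · have hc1 : 0 ≤ t * (z.im - u 1) := mul_nonneg ht0 (by linarith)
        have hc2 : 0 ≤ t * (u 1 + 1 - z.im) := mul_nonneg ht0 (by linarith)
        have h1 : (u 1 : ℝ) < x 1 := by rw [← h, him]; nlinarith
        have h2 : (x 1 : ℝ) < u 1 + 1 := by rw [← h, him]; nlinarith
        have h1' : u 1 < x 1 := by exact_mod_cast h1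
        have h2' : x 1 < u 1 + 1 := by exact_mod_cast h2
        omega
  -- hence `z` lies in the component of the face centre in the complement of the polygon
  have hKc : IsClosed (range (walkPath p)) := (isCompact_range (walkPath p).continuous).isClosed
  have hzc : z ∈ connectedComponentIn (range (walkPath p))ᶜ ℓ :=
    (convex_segment ℓ z).isPreconnected.subset_connectedComponentIn (left_mem_segment ℝ ℓ z) hseg
      (right_mem_segment ℝ ℓ z)
  have heq := wind_sub_eq_of_mem_connectedComponentIn (walkPath p).continuous_extend.continuousOn
    (by rw [Path.extend_zero, Path.extend_one]) hKc
    (fun t ht => by rw [Path.extend_apply _ ht]; exact mem_range_self _) hzc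
  rw [hwind, hz0] at heq
  exact hw heq

end Summit.CriticalPhenomena.SAWScalingLimit.Theorems.AvoidanceLimit.Anchor

end
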